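import Literature.AlgebraicGeometry.ComplexMultiplication.CMTorusProductsMumfordTateRankBounds
import Literature.Geometry.Kaehler.ComplexTorusPicardNumberPoincareLength
import Literature.Geometry.Kaehler.ComplexTorusProductHomRank
import Literature.NumberTheory.ComplexMultiplication.CMTypeRankTwoBlocks
import Literature.NumberTheory.ComplexMultiplication.CMTypeDictionaryGroupLevel
import HarnessLib

/-!
# The Mumford–Tate dimension of the BINARY product `X × Y = ComplexTorus (prodPeriod P Q)` of two products of CM tori:
# `dim MT(H¹(X × Y)) = rank(Σ ⊔ Σ')`, `dim MT(H¹ X) ≤ dim MT(H¹(X × Y)) ≤ dim MT(H¹ X) + dim MT(H¹ Y) − 1`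
# (Moonen–Zarhin 1999 (3.1) on the lane's binary carrier `prodPeriod`, for CM tori)

Family `hodge`, lane `lit-hodgefound` (Track 2; Layers A1/A2/A3: rows A1-23 «Mumford–Tate group», A1-24 / A2 (the binary
product carrier `ComplexTorus.prodPeriod`), A3.5.5), topic `Literature/AlgebraicGeometry/ComplexMultiplication`, namespace
`Literature.AlgebraicGeometry.ComplexMultiplication.CMTorus`.  THEOREMS ONLY (no definition, no named fact; D-0026 net debt
`0`).  Sequel BY NAME of `CMTorusProductsMumfordTateRank` / `…Bounds` (rows g10-#2/#3, the dependent product carrier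
`sigmaPiPeriod`): the same statements on the BINARY carrier `prodPeriod P Q` (`ComplexTorusProduct`), on which the lane's
Künneth files (A1-24) and the two-factor decompositions are stated — so that `dim MT(H¹(X × Y))` of a product of two
products of CM tori `X = ∏_i B_i`, `Y = ∏_j B'_j` (CM types of DIFFERENT families of fields) is available by name.  The
variety-level twin is the tree's `Pohlmann1968/HodgeClassesProductSpanOfMumfordTateRank`
(`mtRank_hodge_one_eq_typeRank_sum_of_isIsogenous_prod`, `mtRank_hodge_one_prod_add_one_le` on `BettiUniverse.hodge` of
abelian varieties); its gluing of the two families over `I ⊔ J` is re-run here inside the proofs (nothing restated).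

THE PRINTS.  B. Moonen, Yu. Zarhin [MoonenZarhin1999LowDim] §3 (3.1) (held `paper:arxiv-math_9901113` p. 6): «Let `X_1`
and `X_2` be complex abelian varieties. Write `X = X_1 × X_2`. Then `Hg(X)` is an algebraic subgroup of
`Hg(X_1) × Hg(X_2)`. The two projections `pr_i : Hg(X) → Hg(X_i)` are surjective.»  P. Deligne [Deligne1982HodgeCycles]
I Ex. 3.7 (c): `dim MT(∏ A_{Φ}) =` the rank of the Galois module generated by the type — for `X × Y` the type is the
disjoint union `Σ ⊔ Σ' ⊆ (⊔_i Hom(K_i, ℂ)) ⊔ (⊔_j Hom(K'_j, ℂ))` (the tree's two-block rank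
`typeRank (ℂ ≃+* ℂ) {z | Sum.elim (· ∈ Σ) (· ∈ Σ') z}` of `CMTypeRankTwoBlocks`, `typeRank_sum_add_one_le`:
«`rank(Σ₁ ⊔ Σ₂) + 1 ≤ rank Σ₁ + rank Σ₂`»).  B. B. Gordon [Gordon1999HodgeAVSurvey] 7.7 «in general `rank Hg(A) ≤ rdim A`»,
9.1.  H. Lange [Lange2023AbelianVarietiesComplex] §2.4.4 Thm. 2.4.25 (products of tori; the tree's
`isIsomorphic_sigmaPiPeriod_sumEquiv`: `∏_{I ⊔ J} ≅ (∏_I) × (∏_J)`), §1.1.2 Cor. 1.1.16 (`IsIsogenous.prod`).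

WHAT IS PROVED (`K_i` (`i ∈ I`), `K'_j` (`j ∈ J`) number fields with CM types `Φ_i`, `Φ'_j`, bases `μ_i`, `μ'_j`;
`X = ComplexTorus (sigmaPiPeriod fun i ↦ periodEquiv (Φ i) (μ i))`, `Y` likewise; `X × Y = ComplexTorus (prodPeriod _ _)`;
finite-dimensionality of the `H¹` carriers as instance arguments; `[HodgeTensorFacts.{0,0}]`):
* **`mtRank_hodgeStructure_prodPeriod_eq_typeRank_sum`** — `dim MT(H¹(X × Y, ℚ)) = rank(Σ ⊔ Σ')` (Deligne (c) for the CM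
  algebra `∏ K_i × ∏ K'_j`, on the binary product torus; ANY number fields);
* **`mtRank_hodgeStructure_prodPeriod_add_one_le`** — `dim MT(H¹(X × Y)) + 1 ≤ dim MT(H¹ X) + dim MT(H¹ Y)` («`Hg(X) ⊆
  Hg(X_1) × Hg(X_2)`», CM fields);
* **`mtRank_hodgeStructure_le_mtRank_prodPeriod_left` / `_right`** — `dim MT(H¹ X) ≤ dim MT(H¹(X × Y))`,
  `dim MT(H¹ Y) ≤ dim MT(H¹(X × Y))` («the two projections are surjective»);
* **`mtRank_hodgeStructure_prodPeriod_eq_typeRank_sum_of_isIsogenous`** — the same number for EVERY `X' ∼ X`, `Y' ∼ Y`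
  (`X' × Y' ∼ X × Y`, `IsIsogenous.prod`, + the isogeny invariance of row g10-#1).

## References
* [MoonenZarhin1999LowDim] B. Moonen, Yu. Zarhin, Math. Ann. 315 (1999) — §3 (3.1).
* [Deligne1982HodgeCycles] P. Deligne, LNM 900 (1982) — I Example 3.7 (c).
* [Gordon1999HodgeAVSurvey] B. B. Gordon (1999) — 7.7, 9.1, 2.1.7.
* [Lange2023AbelianVarietiesComplex] H. Lange (2023) — §1.1.2 Cor. 1.1.16, §2.4.4 Thm. 2.4.25.

## Provenance
Lane `lit-hodgefound`, prover seat `lit-hodgefound-p29` (generation 10), row g10-#5; consumes BY NAME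
`CMTorusProductsMumfordTateRank` (`mtRank_hodgeStructure_sigmaPiPeriod_eq_cmFamilyRank`), `ComplexTorusMumfordTateRankIsogeny`
(`IsIsomorphic/IsIsogenous.mtRank_hodgeStructure_eq`), `Geometry/Kaehler/ComplexTorusPicardNumberPoincareLength`
(`isIsomorphic_sigmaPiPeriod_sumEquiv`), `…/ComplexTorusProductHomRank` (`IsIsogenous.prod`),
`NumberTheory/ComplexMultiplication/CMTypeRankTwoBlocks` (`typeRank_sum_add_one_le`), `…/CMTypeDictionaryGroupLevel`
(`typeRank_preimage_eq`), `Pohlmann1968/CMFamilyRankSubfamilies` (`typeRank_preimage_le`), `Pohlmann1968/NondegenerateCMAlgebraTypes`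
(`CMAlgebra.isCMTypeWith_familyType`); the gluing over `I ⊔ J` follows `Pohlmann1968/HodgeClassesProductSpanOfMumfordTateRank`.
-/

noncomputable section

-- Nested instance problems on the carriers `↥(ComplexTorus.rationalForms P k)`, cf. `CMTorusCohomologyOfCMType`.
set_option maxSynthPendingDepth 3

open scoped Classical
open NumberField Module

namespace Literature.AlgebraicGeometry.ComplexMultiplication

open Literature.AlgebraicGeometry.Motives (CMType HodgeStructure)
open Literature.AlgebraicGeometry.Pohlmann1968
open Literature.Geometry.Kaehler
open Literature.Geometry.Kaehler.ComplexTorus (IsIsogenous IsIsomorphic sigmaPiPeriod prodPeriod rationalForms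
  hodgeStructure finiteDimensional_rationalForms isIsomorphic_sigmaPiPeriod_sumEquiv)
open Literature.NumberTheory.ComplexMultiplication (typeRank typeRank_preimage_eq typeRank_preimage_le
  typeRank_sum_add_one_le)
open scoped Literature.NumberTheory.ComplexMultiplication

namespace CMTorus

section Binary

variable {I J : Type} [Fintype I] [Fintype J] {K : I → Type} {K' : J → Type} [∀ i, Field (K i)] [∀ j, Field (K' j)]
  [∀ i, NumberField (K i)] [∀ j, NumberField (K' j)] {ι : I → Type} {ι' : J → Type} [∀ i, Fintype (ι i)]
  [∀ j, Fintype (ι' j)] (Φ : ∀ i, CMType (K i)) (Φ' : ∀ j, CMType (K' j)) (μ : ∀ i, Basis (ι i) ℚ (K i))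
  (μ' : ∀ j, Basis (ι' j) ℚ (K' j)) [Literature.AlgebraicGeometry.Motives.HodgeTensorFacts.{0, 0}]
  [Module.Finite ℚ (rationalForms (prodPeriod (sigmaPiPeriod fun i => periodEquiv (Φ i) (μ i))
    (sigmaPiPeriod fun j => periodEquiv (Φ' j) (μ' j))) 1)]

/-- **`dim MT(H¹(X × Y, ℚ)) = rank(Σ ⊔ Σ')`** for the binary product `X × Y = ComplexTorus (prodPeriod _ _)` of the
products of CM tori `X = ∏_i ℂ^{Φ_i}/u(𝔪_i)`, `Y = ∏_j ℂ^{Φ'_j}/u(𝔪'_j)` — Deligne's Ex. 3.7 (c) for the CM algebra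
`∏_i K_i × ∏_j K'_j`, whose type is the disjoint union `Σ ⊔ Σ'` (the tree's two-block rank
`typeRank (ℂ ≃+* ℂ) {z | Sum.elim (· ∈ Σ) (· ∈ Σ') z}`): glue the two families over `I ⊔ J`, split the glued product torus as
`(∏_I) × (∏_J)` (`isIsomorphic_sigmaPiPeriod_sumEquiv`), and read `dim MT(∏_{I ⊔ J}) = cmFamilyRank` (row g10-#2) through the
equivariant bijection `(⊔_I Hom) ⊔ (⊔_J Hom) ≃ ⊔_{I ⊔ J} Hom`. [cite: Deligne1982HodgeCycles, I Example 3.7 (c)]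
[cite: Gordon1999HodgeAVSurvey, 9.1] [cite: Lange2023AbelianVarietiesComplex, §2.4.4 Thm. 2.4.25] -/
theorem mtRank_hodgeStructure_prodPeriod_eq_typeRank_sum :
    (hodgeStructure (prodPeriod (sigmaPiPeriod fun i => periodEquiv (Φ i) (μ i))
        (sigmaPiPeriod fun j => periodEquiv (Φ' j) (μ' j))) 1).mtRank =
      typeRank (ℂ ≃+* ℂ) {z : (Σ i, (K i →+* ℂ)) ⊕ (Σ j, (K' j →+* ℂ)) |
        Sum.elim (· ∈ CMAlgebra.familyType Φ) (· ∈ CMAlgebra.familyType Φ') z} := by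
  -- the glued family over `I ⊔ J`
  letI instF : ∀ k, Field (Sum.elim K K' k) := fun k =>
    Sum.rec (motive := fun k => Field (Sum.elim K K' k)) (fun i => inferInstanceAs (Field (K i)))
      (fun j => inferInstanceAs (Field (K' j))) k
  letI instN : ∀ k, NumberField (Sum.elim K K' k) := fun k =>
    Sum.rec (motive := fun k => NumberField (Sum.elim K K' k)) (fun i => inferInstanceAs (NumberField (K i)))
      (fun j => inferInstanceAs (NumberField (K' j))) k
  letI instι : ∀ k, Fintype (Sum.elim ι ι' k) := fun k =>
    Sum.rec (motive := fun k => Fintype (Sum.elim ι ι' k)) (fun i => inferInstanceAs (Fintype (ι i)))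
      (fun j => inferInstanceAs (Fintype (ι' j))) k
  let ΦJ : ∀ k, CMType (Sum.elim K K' k) := fun k => Sum.rec (motive := fun k => CMType (Sum.elim K K' k)) Φ Φ' k
  let μJ : ∀ k, Basis (Sum.elim ι ι' k) ℚ (Sum.elim K K' k) := fun k =>
    Sum.rec (motive := fun k => Basis (Sum.elim ι ι' k) ℚ (Sum.elim K K' k)) μ μ' k
  -- `∏_{I ⊔ J} B_k ≅ (∏_I B_i) × (∏_J B'_j)`
  have hiso : IsIsomorphic (sigmaPiPeriod fun k => periodEquiv (ΦJ k) (μJ k))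
      (prodPeriod (sigmaPiPeriod fun i => periodEquiv (Φ i) (μ i)) (sigmaPiPeriod fun j => periodEquiv (Φ' j) (μ' j))) :=
    isIsomorphic_sigmaPiPeriod_sumEquiv (fun k => periodEquiv (ΦJ k) (μJ k)) (Equiv.refl (I ⊕ J))
  haveI := finiteDimensional_rationalForms (sigmaPiPeriod fun k => periodEquiv (ΦJ k) (μJ k)) 1
  rw [← IsIsomorphic.mtRank_hodgeStructure_eq _ _ (k := 1) hiso, mtRank_hodgeStructure_sigmaPiPeriod_eq_cmFamilyRank ΦJ μJ]
  -- `cmFamilyRank ΦJ = rank(Σ ⊔ Σ')`: the equivariant bijection `(⊔_I Hom) ⊔ (⊔_J Hom) ≃ ⊔_{I ⊔ J} Hom`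
  let e : ((Σ i, (K i →+* ℂ)) ⊕ (Σ j, (K' j →+* ℂ))) ≃ (Σ k : I ⊕ J, (Sum.elim K K' k →+* ℂ)) :=
    { toFun := Sum.elim (fun x => ⟨Sum.inl x.1, x.2⟩) (fun y => ⟨Sum.inr y.1, y.2⟩)
      invFun := fun z => Sum.rec
        (motive := fun k => (Sum.elim K K' k →+* ℂ) → (Σ i, (K i →+* ℂ)) ⊕ (Σ j, (K' j →+* ℂ)))
        (fun i s => Sum.inl ⟨i, s⟩) (fun j t => Sum.inr ⟨j, t⟩) z.1 z.2
      left_inv := fun z => by rcases z with ⟨i, s⟩ | ⟨j, t⟩ <;> rfl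
      right_inv := fun z => by
        obtain ⟨k, s⟩ := z
        rcases k with i | j <;> rfl }
  have hpre : e ⁻¹' CMAlgebra.familyType ΦJ =
      {z : (Σ i, (K i →+* ℂ)) ⊕ (Σ j, (K' j →+* ℂ)) |
        Sum.elim (· ∈ CMAlgebra.familyType Φ) (· ∈ CMAlgebra.familyType Φ') z} := by
    ext z
    rcases z with ⟨i, s⟩ | ⟨j, t⟩ <;> rfl
  rw [← hpre, CMAlgebra.cmFamilyRank]
  refine (typeRank_preimage_eq (G := ℂ ≃+* ℂ) (G' := ℂ ≃+* ℂ) (CMAlgebra.familyType ΦJ) e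
    (fun τ => ⟨τ, fun z => ?_⟩) (fun τ => ⟨τ, fun z => ?_⟩)).symm <;>
  · rcases z with ⟨i, s⟩ | ⟨j, t⟩ <;> rfl

/-- **«`Hg(X) ⊆ Hg(X_1) × Hg(X_2)`» on the binary carrier, rank form for CM tori of CM fields:
`dim MT(H¹(X × Y, ℚ)) + 1 ≤ dim MT(H¹(X, ℚ)) + dim MT(H¹(Y, ℚ))`** (`dim MT = dim Hg + 1`; the two-block bound
`rank(Σ ⊔ Σ') + 1 ≤ rank Σ + rank Σ'`). [cite: MoonenZarhin1999LowDim, §3 (3.1)] [cite: Gordon1999HodgeAVSurvey, 7.7]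
[cite: Deligne1982HodgeCycles, I Example 3.7 (c)] -/
theorem mtRank_hodgeStructure_prodPeriod_add_one_le [∀ i, IsCMField (K i)] [∀ j, IsCMField (K' j)] [Nonempty I]
    [Nonempty J] [Module.Finite ℚ (rationalForms (sigmaPiPeriod fun i => periodEquiv (Φ i) (μ i)) 1)]
    [Module.Finite ℚ (rationalForms (sigmaPiPeriod fun j => periodEquiv (Φ' j) (μ' j)) 1)] :
    (hodgeStructure (prodPeriod (sigmaPiPeriod fun i => periodEquiv (Φ i) (μ i))
        (sigmaPiPeriod fun j => periodEquiv (Φ' j) (μ' j))) 1).mtRank + 1 ≤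
      (hodgeStructure (sigmaPiPeriod fun i => periodEquiv (Φ i) (μ i)) 1).mtRank +
        (hodgeStructure (sigmaPiPeriod fun j => periodEquiv (Φ' j) (μ' j)) 1).mtRank := by
  rw [mtRank_hodgeStructure_prodPeriod_eq_typeRank_sum, mtRank_hodgeStructure_sigmaPiPeriod_eq_cmFamilyRank,
    mtRank_hodgeStructure_sigmaPiPeriod_eq_cmFamilyRank]
  haveI : Nonempty (Σ i, (K i →+* ℂ)) := by
    obtain ⟨i⟩ := ‹Nonempty I›
    obtain ⟨s⟩ := (inferInstance : Nonempty (K i →+* ℂ))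
    exact ⟨⟨i, s⟩⟩
  haveI : Nonempty (Σ j, (K' j →+* ℂ)) := by
    obtain ⟨j⟩ := ‹Nonempty J›
    obtain ⟨t⟩ := (inferInstance : Nonempty (K' j →+* ℂ))
    exact ⟨⟨j, t⟩⟩
  exact typeRank_sum_add_one_le (CMAlgebra.isCMTypeWith_familyType Φ) (CMAlgebra.isCMTypeWith_familyType Φ')

/-- **«The projection `pr_1 : Hg(X × Y) → Hg(X)` is surjective», rank form: `dim MT(H¹(X, ℚ)) ≤ dim MT(H¹(X × Y, ℚ))`**
(Kubota's rank can only drop along the equivariant inclusion `⊔_I Hom ↪ (⊔_I Hom) ⊔ (⊔_J Hom)`, `typeRank_preimage_le`).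
[cite: MoonenZarhin1999LowDim, §3 (3.1)] [cite: Gordon1999HodgeAVSurvey, 7.6.1] -/
theorem mtRank_hodgeStructure_le_mtRank_prodPeriod_left
    [Module.Finite ℚ (rationalForms (sigmaPiPeriod fun i => periodEquiv (Φ i) (μ i)) 1)] :
    (hodgeStructure (sigmaPiPeriod fun i => periodEquiv (Φ i) (μ i)) 1).mtRank ≤
      (hodgeStructure (prodPeriod (sigmaPiPeriod fun i => periodEquiv (Φ i) (μ i))
        (sigmaPiPeriod fun j => periodEquiv (Φ' j) (μ' j))) 1).mtRank := by
  rw [mtRank_hodgeStructure_prodPeriod_eq_typeRank_sum, mtRank_hodgeStructure_sigmaPiPeriod_eq_cmFamilyRank]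
  exact typeRank_preimage_le (G := ℂ ≃+* ℂ)
    {z : (Σ i, (K i →+* ℂ)) ⊕ (Σ j, (K' j →+* ℂ)) |
      Sum.elim (· ∈ CMAlgebra.familyType Φ) (· ∈ CMAlgebra.familyType Φ') z} Sum.inl fun _ _ => rfl

/-- **… and `pr_2`: `dim MT(H¹(Y, ℚ)) ≤ dim MT(H¹(X × Y, ℚ))`.** [cite: MoonenZarhin1999LowDim, §3 (3.1)]
[cite: Gordon1999HodgeAVSurvey, 7.6.1] -/
theorem mtRank_hodgeStructure_le_mtRank_prodPeriod_right
    [Module.Finite ℚ (rationalForms (sigmaPiPeriod fun j => periodEquiv (Φ' j) (μ' j)) 1)] :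
    (hodgeStructure (sigmaPiPeriod fun j => periodEquiv (Φ' j) (μ' j)) 1).mtRank ≤
      (hodgeStructure (prodPeriod (sigmaPiPeriod fun i => periodEquiv (Φ i) (μ i))
        (sigmaPiPeriod fun j => periodEquiv (Φ' j) (μ' j))) 1).mtRank := by
  rw [mtRank_hodgeStructure_prodPeriod_eq_typeRank_sum, mtRank_hodgeStructure_sigmaPiPeriod_eq_cmFamilyRank]
  exact typeRank_preimage_le (G := ℂ ≃+* ℂ)
    {z : (Σ i, (K i →+* ℂ)) ⊕ (Σ j, (K' j →+* ℂ)) |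
      Sum.elim (· ∈ CMAlgebra.familyType Φ) (· ∈ CMAlgebra.familyType Φ') z} Sum.inr fun _ _ => rfl

/-- **Every `X' ∼ X`, `Y' ∼ Y`**: `dim MT(H¹(X' × Y', ℚ)) = rank(Σ ⊔ Σ')` (`X' × Y' ∼ X × Y`, Lange Cor. 1.1.16, the tree's
`IsIsogenous.prod`; the Mumford–Tate dimension is an isogeny invariant, row g10-#1).
[cite: Lange2023AbelianVarietiesComplex, §1.1.2 Cor. 1.1.16] [cite: Gordon1999HodgeAVSurvey, 2.1.7 and 9.1]
[cite: Deligne1982HodgeCycles, I Example 3.7 (c)] -/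
theorem mtRank_hodgeStructure_prodPeriod_eq_typeRank_sum_of_isIsogenous {κ₁ κ₂ : Type} [Fintype κ₁] [Fintype κ₂]
    {E₁ E₂ : Type} [NormedAddCommGroup E₁] [NormedSpace ℂ E₁] [NormedAddCommGroup E₂] [NormedSpace ℂ E₂]
    {P : (κ₁ → ℝ) ≃L[ℝ] E₁} {Q : (κ₂ → ℝ) ≃L[ℝ] E₂} [Module.Finite ℚ (rationalForms (prodPeriod P Q) 1)]
    (hP : IsIsogenous P (sigmaPiPeriod fun i => periodEquiv (Φ i) (μ i)))
    (hQ : IsIsogenous Q (sigmaPiPeriod fun j => periodEquiv (Φ' j) (μ' j))) :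
    (hodgeStructure (prodPeriod P Q) 1).mtRank =
      typeRank (ℂ ≃+* ℂ) {z : (Σ i, (K i →+* ℂ)) ⊕ (Σ j, (K' j →+* ℂ)) |
        Sum.elim (· ∈ CMAlgebra.familyType Φ) (· ∈ CMAlgebra.familyType Φ') z} := by
  rw [(hP.prod hQ).mtRank_hodgeStructure_eq _ _, mtRank_hodgeStructure_prodPeriod_eq_typeRank_sum]

end Binary

end CMTorus

end Literature.AlgebraicGeometry.ComplexMultiplication

end
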